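import Mathlib.Analysis.SpecialFunctions.Trigonometric.DerivHyp
import Literature.Probability.LatticeModels.UrsellMonotonicityProofs
import HarnessLib

/-!
# Camia–Jiang–Newman 2023, Theorem 1: reduction to distinct pendant sites (the clone trick)

Topic `Literature/Probability/LatticeModels`; sibling file of `UrsellMonotonicity.lean` (named fact
`CamiaJiangNewman2023_thm1`).  CJN prove their Theorem 1 first for DISTINCT sites `j_1, …, j_{2k}` with
`v₀ ∉ {j}` (§3, Prop. 1) and then remove these restrictions in §4 (Lemma 8: a new vertex `w` with
`cosh 2β̂ = e^{2β}`; Lemma 9 = Sylvester's reduction formula for coincident arguments; Claim 3: an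
induction on the number of coincident pairs).  This file replaces all of §4 by one exact identity
(Griffiths' "ghost/clone spin" trick): enlarge the index set `ι` to `ι ⊕ Fin n` and couple the clone
`inr i` to its host `inl (j i)` only, with coupling `K`.  Summing out the clones,

* `PairIsing.avg_cloneCoupling_mul_prod` — `⟨f(σ) ∏_{i∈B} τ_i⟩_{c'} = (tanh K)^{|B|} ⟨f(σ) ∏_{i∈B} σ_{j i}⟩_c`
  (the `ι`-marginal is unchanged and each clone is `σ_{j i}` "with probability `tanh K`"),
* `PairIsing.ursell_cloneCoupling` — `u_n(c'; inr) = (tanh K)^n · u_n(c; j)`,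
* `PairIsing.cloneCoupling_setCoupling` — perturbing `c_{u₀v₀}` commutes with cloning,

whence `CamiaJiangNewman2023_thm1_of_injective`: **Theorem 1 for arbitrary `j : Fin 2k → ι` and
arbitrary `u₀ ≠ v₀` follows from Theorem 1 for INJECTIVE `j` with `u₀, v₀ ∉ range j`** (apply the
restricted statement on `ι ⊕ Fin 2k` to `j' = inr`, `u₀' = inl u₀`, `v₀' = inl v₀`, `K = 1`).

No named facts; one definition (`PairIsing.cloneCoupling`, with body).

## References

* [CamiaJiangNewman2023] F. Camia, J. Jiang, C. M. Newman, CMP 401 (2023), arXiv:2207.12247, §4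
  (Lemmas 8, 9, Claim 3 — the statements this file makes unnecessary).
* R. B. Griffiths, J. Math. Phys. 10 (1969) 1559 (analogue/ghost spins) [Griffiths1969] — the trick.
-/

noncomputable section

open Finset

namespace Literature.Probability.LatticeModels

namespace PairIsing

variable {ι : Type*} [Fintype ι] [DecidableEq ι]

/-! ### The cloned coupling matrix -/

/-- The couplings on `ι ⊕ Fin n` obtained from `c` by attaching, for each `i : Fin n`, a pendant
"clone" site `inr i` to the host `inl (j i)` with (one-directional) coupling `K`; clones do not
interact with each other or with other sites. [cite: CamiaJiangNewman2023, §4 (replaced)] -/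
def cloneCoupling (c : ι → ι → ℝ) {n : ℕ} (j : Fin n → ι) (K : ℝ) : ι ⊕ Fin n → ι ⊕ Fin n → ℝ
  | Sum.inl a, Sum.inl b => c a b
  | Sum.inr i, Sum.inl b => if b = j i then K else 0
  | Sum.inl _, Sum.inr _ => 0
  | Sum.inr _, Sum.inr _ => 0

omit [Fintype ι] in
/-- Nonnegative couplings stay nonnegative after cloning with `K ≥ 0`. [folklore] -/
theorem cloneCoupling_nonneg {c : ι → ι → ℝ} (hc : ∀ a b, 0 ≤ c a b) {n : ℕ} (j : Fin n → ι) {K : ℝ}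
    (hK : 0 ≤ K) (x y : ι ⊕ Fin n) : 0 ≤ cloneCoupling c j K x y := by
  rcases x with a | i <;> rcases y with b | i'
  · exact hc a b
  · exact le_rfl
  · simp only [cloneCoupling]; split_ifs; exacts [hK, le_rfl]
  · exact le_rfl

omit [Fintype ι] in
/-- Cloning commutes with perturbing an `ι`-entry of the coupling matrix. [folklore] -/
theorem cloneCoupling_setCoupling (c : ι → ι → ℝ) {n : ℕ} (j : Fin n → ι) (K : ℝ) (u₀ v₀ : ι)
    (t : ℝ) :
    cloneCoupling (setCoupling c u₀ v₀ t) j K =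
      setCoupling (cloneCoupling c j K) (Sum.inl u₀) (Sum.inl v₀) t := by
  funext x y
  rcases x with a | i <;> rcases y with b | i'
  · simp only [cloneCoupling, setCoupling, Sum.inl.injEq]
  · simp [cloneCoupling, setCoupling]
  · simp [cloneCoupling, setCoupling]
  · simp [cloneCoupling, setCoupling]

omit [Fintype ι] in
/-- The `(inl u₀, inl v₀)` entry of the cloned matrix is `c u₀ v₀`. [folklore] -/
@[simp] theorem cloneCoupling_inl_inl (c : ι → ι → ℝ) {n : ℕ} (j : Fin n → ι) (K : ℝ) (a b : ι) :
    cloneCoupling c j K (Sum.inl a) (Sum.inl b) = c a b := rfl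

/-! ### The weights of the cloned model -/

omit [Fintype ι] [DecidableEq ι] in
/-- The spin at a host site, read off the restriction of the configuration to `ι`. [folklore] -/
theorem spinAt_comp_inl {n : ℕ} (a : ι) (ρ : SpinConfig (ι ⊕ Fin n)) :
    spinAt a (fun b => ρ (Sum.inl b)) = spinAt (Sum.inl a) ρ := rfl

/-- The exponent of the cloned model: the original exponent plus `K Σ_i τ_i σ_{j i}`. [folklore] -/
theorem sum_sum_cloneCoupling_mul_spin (c : ι → ι → ℝ) {n : ℕ} (j : Fin n → ι) (K : ℝ)
    (ρ : SpinConfig (ι ⊕ Fin n)) :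
    ∑ x, ∑ y, cloneCoupling c j K x y * (spinAt x ρ * spinAt y ρ) =
      (∑ a, ∑ b, c a b * (spinAt a (fun b => ρ (Sum.inl b)) * spinAt b (fun b => ρ (Sum.inl b)))) +
        ∑ i, K * (spinAt (Sum.inr i) ρ * spinAt (Sum.inl (j i)) ρ) := by
  simp only [Fintype.sum_sum_type, cloneCoupling, zero_mul, Finset.sum_const_zero, add_zero,
    spinAt_comp_inl]
  congr 1
  refine Finset.sum_congr rfl fun i _ => ?_
  simp_rw [ite_mul, zero_mul]
  rw [Finset.sum_ite_eq' univ (j i)]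
  simp

/-- **The Boltzmann weight of the cloned model factorises**:
`w_{c'}(σ,τ) = w_c(σ) ∏_i exp(K τ_i σ_{j i})`. [folklore] -/
theorem weight_cloneCoupling (c : ι → ι → ℝ) {n : ℕ} (j : Fin n → ι) (K : ℝ)
    (ρ : SpinConfig (ι ⊕ Fin n)) :
    weight (cloneCoupling c j K) ρ =
      weight c (fun b => ρ (Sum.inl b)) *
        ∏ i, Real.exp (K * (spinAt (Sum.inr i) ρ * spinAt (Sum.inl (j i)) ρ)) := by
  rw [weight, weight, sum_sum_cloneCoupling_mul_spin, Real.exp_add]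
  congr 1
  exact Real.exp_sum _ _

/-! ### Summing out the clones -/

/-- One clone: `Σ_{t=±1} t^{[b]} e^{K t s} = (e^K ∓ e^{-K})·(s if b)` for `s = ±1`. [folklore] -/
theorem sum_units_clone (K : ℝ) {s : ℝ} (hs : s = 1 ∨ s = -1) (b : Prop) [Decidable b] :
    ∑ t : ℤˣ, (if b then ((t : ℤ) : ℝ) else 1) * Real.exp (K * (((t : ℤ) : ℝ) * s)) =
      if b then (Real.exp K - Real.exp (-K)) * s else Real.exp K + Real.exp (-K) := by
  rw [UnitsInt.univ, Finset.sum_insert (by decide), Finset.sum_singleton]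
  simp only [Units.val_one, Int.cast_one, Units.val_neg, Int.cast_neg]
  rcases hs with rfl | rfl <;> by_cases hb : b <;> simp [hb] <;> ring_nf

/-- **Summing out all clones**: for `σ` fixed (`s_i = σ_{j i} = ±1`) and `B ⊆ Fin n`,
`Σ_τ (∏_{i∈B} τ_i) ∏_i e^{K τ_i s_i} = (e^K+e^{-K})^{|Bᶜ|} (e^K-e^{-K})^{|B|} ∏_{i∈B} s_i`. [folklore] -/
theorem sum_prod_clone (K : ℝ) {n : ℕ} (s : Fin n → ℝ) (hs : ∀ i, s i = 1 ∨ s i = -1)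
    (B : Finset (Fin n)) :
    ∑ τ : Fin n → ℤˣ, (∏ i ∈ B, ((τ i : ℤ) : ℝ)) * ∏ i, Real.exp (K * (((τ i : ℤ) : ℝ) * s i)) =
      (Real.exp K + Real.exp (-K)) ^ Bᶜ.card * ((Real.exp K - Real.exp (-K)) ^ B.card *
        ∏ i ∈ B, s i) := by
  have h1 : ∀ τ : Fin n → ℤˣ, (∏ i ∈ B, ((τ i : ℤ) : ℝ)) * ∏ i, Real.exp (K * (((τ i : ℤ) : ℝ) * s i)) =
      ∏ i, (if i ∈ B then ((τ i : ℤ) : ℝ) else 1) * Real.exp (K * (((τ i : ℤ) : ℝ) * s i)) := by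
    intro τ
    rw [Finset.prod_mul_distrib, Finset.prod_ite_mem, Finset.univ_inter]
  simp_rw [h1]
  rw [← Fintype.prod_sum fun i (t : ℤˣ) =>
    (if i ∈ B then ((t : ℤ) : ℝ) else 1) * Real.exp (K * (((t : ℤ) : ℝ) * s i))]
  simp_rw [sum_units_clone K (hs _)]
  rw [Finset.prod_ite, Finset.prod_mul_distrib, Finset.prod_const, Finset.prod_const,
    Finset.filter_mem_eq_inter, Finset.univ_inter, Finset.filter_not, Finset.filter_mem_eq_inter,
    Finset.univ_inter, Finset.sdiff_eq_inter_compl, Finset.univ_inter]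
  ring

/-- The clone-sum constant is positive. [folklore] -/
theorem exp_add_exp_neg_pos (K : ℝ) : 0 < Real.exp K + Real.exp (-K) :=
  add_pos (Real.exp_pos _) (Real.exp_pos _)

/-- `(e^K - e^{-K})/(e^K + e^{-K}) = tanh K`. [folklore] -/
theorem exp_sub_div_exp_add (K : ℝ) :
    (Real.exp K - Real.exp (-K)) / (Real.exp K + Real.exp (-K)) = Real.tanh K := by
  rw [Real.tanh_eq_sinh_div_cosh, Real.sinh_eq, Real.cosh_eq]
  field_simp

/-- **The weighted configuration sums of the cloned model**: for an observable `f` of the `ι`-spins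
and a set `B` of clones,
`Σ_{(σ,τ)} f(σ) (∏_{i∈B} τ_i) w_{c'}(σ,τ) = (e^K+e^{-K})^{|Bᶜ|}(e^K-e^{-K})^{|B|} Σ_σ f(σ)(∏_{i∈B}σ_{j i}) w_c(σ)`.
[folklore] -/
theorem sum_mul_prod_mul_weight_cloneCoupling (c : ι → ι → ℝ) {n : ℕ} (j : Fin n → ι) (K : ℝ)
    (f : SpinConfig ι → ℝ) (B : Finset (Fin n)) :
    ∑ ρ : SpinConfig (ι ⊕ Fin n), f (fun b => ρ (Sum.inl b)) * (∏ i ∈ B, spinAt (Sum.inr i) ρ) *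
        weight (cloneCoupling c j K) ρ =
      (Real.exp K + Real.exp (-K)) ^ Bᶜ.card * (Real.exp K - Real.exp (-K)) ^ B.card *
        ∑ σ : SpinConfig ι, f σ * (∏ i ∈ B, spinAt (j i) σ) * weight c σ := by
  rw [← (Equiv.sumArrowEquivProdArrow ι (Fin n) ℤˣ).symm.sum_comp, Fintype.sum_prod_type,
    Finset.mul_sum]
  refine Finset.sum_congr rfl fun σ _ => ?_
  have hrw : ∀ τ : Fin n → ℤˣ,
      f (fun b => (Equiv.sumArrowEquivProdArrow ι (Fin n) ℤˣ).symm (σ, τ) (Sum.inl b)) *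
          (∏ i ∈ B, spinAt (Sum.inr i) ((Equiv.sumArrowEquivProdArrow ι (Fin n) ℤˣ).symm (σ, τ))) *
          weight (cloneCoupling c j K) ((Equiv.sumArrowEquivProdArrow ι (Fin n) ℤˣ).symm (σ, τ)) =
        f σ * weight c σ * ((∏ i ∈ B, ((τ i : ℤ) : ℝ)) *
          ∏ i, Real.exp (K * (((τ i : ℤ) : ℝ) * spinAt (j i) σ))) := by
    intro τ
    rw [weight_cloneCoupling]
    simp only [Equiv.sumArrowEquivProdArrow_symm_apply_inl, Equiv.sumArrowEquivProdArrow_symm_apply_inr,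
      spinAt]
    ring
  simp_rw [hrw]
  rw [← Finset.mul_sum, sum_prod_clone K (fun i => spinAt (j i) σ) (fun i => spinAt_eq_one_or_eq_neg_one _ _) B]
  ring

/-- **Gibbs averages of the cloned model**: `⟨f(σ) ∏_{i∈B} τ_i⟩_{c'} = (tanh K)^{|B|} ⟨f(σ) ∏_{i∈B} σ_{j i}⟩_c`
(in particular the `ι`-marginal of the cloned model is the original model).
[cite: CamiaJiangNewman2023, §4 (replaced)] -/
theorem avg_cloneCoupling_mul_prod (c : ι → ι → ℝ) {n : ℕ} (j : Fin n → ι) (K : ℝ)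
    (f : SpinConfig ι → ℝ) (B : Finset (Fin n)) :
    avg (cloneCoupling c j K) (fun ρ => f (fun b => ρ (Sum.inl b)) * ∏ i ∈ B, spinAt (Sum.inr i) ρ) =
      Real.tanh K ^ B.card * avg c (fun σ => f σ * ∏ i ∈ B, spinAt (j i) σ) := by
  have hN := sum_mul_prod_mul_weight_cloneCoupling c j K f B
  have hD := sum_mul_prod_mul_weight_cloneCoupling c j K (fun _ => 1) ∅
  simp only [one_mul, Finset.prod_empty, Finset.card_empty, pow_zero, mul_one,
    Finset.compl_empty, Finset.card_univ] at hD
  rw [avg, avg, hN, hD, ← exp_sub_div_exp_add, div_pow]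
  have hA : (Real.exp K + Real.exp (-K)) ≠ 0 := (exp_add_exp_neg_pos K).ne'
  have hZ : (∑ σ : SpinConfig ι, weight c σ) ≠ 0 := (sum_weight_pos c).ne'
  have hcard : Bᶜ.card + B.card = Fintype.card (Fin n) := by
    rw [Finset.card_compl, Nat.sub_add_cancel (Finset.card_le_univ B)]
  rw [← hcard, pow_add]
  field_simp

/-- **Ursell functions of clones**: `u_n(cloneCoupling c j K; inr) = (tanh K)^n · u_n(c; j)`
(each block factor picks up `(tanh K)^{|B|}`, and `Σ_{B∈P} |B| = n`).
[cite: CamiaJiangNewman2023, §4 (replaced)] -/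
theorem ursell_cloneCoupling (c : ι → ι → ℝ) {n : ℕ} (j : Fin n → ι) (K : ℝ) :
    ursell (cloneCoupling c j K) (Sum.inr : Fin n → ι ⊕ Fin n) = Real.tanh K ^ n * ursell c j := by
  unfold ursell
  rw [Finset.mul_sum]
  refine Finset.sum_congr rfl fun P _ => ?_
  have hB : ∀ B ∈ P.parts, avg (cloneCoupling c j K) (fun ρ => ∏ i ∈ B, spinAt (Sum.inr i) ρ) =
      Real.tanh K ^ B.card * avg c (fun σ => ∏ i ∈ B, spinAt (j i) σ) := by
    intro B _
    have h := avg_cloneCoupling_mul_prod c j K (fun _ => 1) B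
    simpa only [one_mul] using h
  rw [Finset.prod_congr rfl hB, Finset.prod_mul_distrib, Finset.prod_pow_eq_pow_sum,
    Finpartition.sum_card_parts, Finset.card_univ, Fintype.card_fin]
  ring

end PairIsing

/-! ### Theorem 1: the general case from the case of distinct sites avoiding `u₀, v₀` -/

/-- **CJN Theorem 1 reduces to injective `j` with `u₀, v₀ ∉ range j`** (replacing CJN §4: Lemma 8,
Lemma 9 and Claim 3).  If `(-1)^{k-1} ∂u_{2k}(σ_{j})/∂J_{u₀v₀} ≥ 0` holds whenever the `2k` sites are
distinct and different from `u₀, v₀`, then it holds for all `j` and all `u₀ ≠ v₀`: apply the hypothesis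
to the cloned model on `ι ⊕ Fin 2k` with sites `inr`, where
`u_{2k}(c'_t; inr) = (tanh 1)^{2k} u_{2k}(c_t; j)` exactly. [cite: CamiaJiangNewman2023, Thm 1 and §4] -/
theorem CamiaJiangNewman2023_thm1_of_injective
    (H : ∀ (ι : Type) [Fintype ι] [DecidableEq ι] (c : ι → ι → ℝ), (∀ a b, 0 ≤ c a b) →
      ∀ (k : ℕ), 1 ≤ k → ∀ (j : Fin (2 * k) → ι) (u₀ v₀ : ι), Function.Injective j →
        u₀ ∉ Set.range j → v₀ ∉ Set.range j → u₀ ≠ v₀ →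
          0 ≤ (-1 : ℝ) ^ (k - 1) *
            deriv (fun t : ℝ => PairIsing.ursell (PairIsing.setCoupling c u₀ v₀ t) j) (c u₀ v₀)) :
    CamiaJiangNewman2023_thm1 := by
  intro ι _ _ c hc k hk j u₀ v₀ huv
  have key := H (ι ⊕ Fin (2 * k)) (PairIsing.cloneCoupling c j 1)
    (PairIsing.cloneCoupling_nonneg hc j zero_le_one) k hk Sum.inr (Sum.inl u₀) (Sum.inl v₀)
    Sum.inr_injective (by simp) (by simp) (by simpa using huv)
  have hfun : (fun t : ℝ => PairIsing.ursell
      (PairIsing.setCoupling (PairIsing.cloneCoupling c j 1) (Sum.inl u₀) (Sum.inl v₀) t) Sum.inr) =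
      fun t => Real.tanh 1 ^ (2 * k) * PairIsing.ursell (PairIsing.setCoupling c u₀ v₀ t) j := by
    funext t
    rw [← PairIsing.cloneCoupling_setCoupling, PairIsing.ursell_cloneCoupling]
  rw [hfun, PairIsing.cloneCoupling_inl_inl,
    deriv_const_mul _ ((PairIsing.differentiable_ursell_setCoupling c u₀ v₀ j) _)] at key
  have hpos : 0 < Real.tanh 1 ^ (2 * k) := by
    refine pow_pos ?_ _
    rw [Real.tanh_eq_sinh_div_cosh]
    exact div_pos (Real.sinh_pos_iff.2 one_pos) (Real.cosh_pos 1)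
  rw [mul_left_comm] at key
  exact nonneg_of_mul_nonneg_right (by simpa [mul_comm] using key) hpos

end Literature.Probability.LatticeModels
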